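import Summits.Ventures.CertifiedManyBodySolver.Observables.StiffnessApexTransportBandBoxes
import Summits.Ventures.CertifiedManyBodySolver.Observables.StiffnessApexTransportMottStation
import HarnessLib

/-!
# Ventures/CertifiedManyBodySolver — Observables/StiffnessApexTransportMottFanBoxes.lean

HONEST FRAMING: one-sided certified CEILINGS on the uniform flux stiffness (t–t′ f-sum class) at HALF FILLING `n = 1` (the Mott CONTROL/CALIBRATION line — `ρ_s = 0` there is
print, NOT a theorem) on WHOLE BOXES `[U_a, U_b] × [t′₁, t′₂]`, `t′ < 0`, bracketed by a FAN source (left) and a PH-SIGNED MOTT STATION (right) — AREA words; every word CONDITIONAL on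
the fan's rows and the station's kinetic ceiling BY NAME; a ceiling never speaks to the presence of order; not a `T_c` estimate, not a superconductivity verdict; no number of record.
Zero compute, no definition, no claim node, no `sorry`.

Cell `pub/hubbard-fast` (D-0154 (1)(A)), seat `hubbard-fast-reuse-2` g6 (`prover-hubbard-fast-reuse-2-g6-0`), path family «APEX TRANSPORT», line «U-AFFINE BOXES», object «MOTT × FAN BOXES»:
the AREA form of g5's Mott × fan POINT words and SECTIONS (`Observables/StiffnessApexTransportMottStationFan.lean`, `…FanSections.lean`, p667774/p669727). The two-station cleared
word of the companion `Observables/StiffnessApexTransportTwoStationBoxes.lean` (same seat, same session) with the RIGHT member replaced by the EXISTENTIAL Mott witness of g5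
(`exists_torusLimit_halfFilling_tp0_hoppingFloor_of_negKinetic_le`: on the `(0, U₀, 1)` class some torus-limit ground state has `−X ≤ e_{Φ(1,κ,0)}` at EVERY `κ`, no `K₂` price — the
particle–hole map flips `K₂`), fed to g5's `ObsStiffnessSeqCeilingAt_of_apexSourceWitness_apexSource_weighted`. With `d₁ = U − U₁` (fan station), `d₂ = U − U₀` (Mott station),
`K_a = Us_a − U₁t`, `K_b = −U₀t`, `E = K_b d₁ − K_a d₂`:

  `P(U,t) := 4cE + (K_b − 2td₂)(α_a d₁ + β_a K_a) + (2td₁ − K_a)(−X·d₂) ≥ 0` — QUADRATIC in `U` with leading coefficient `q(t) = −4cs_a − 2t(α_a + β_a s_a) − (2t − s_a)X`,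

so the companion's `quadraticU_nonneg_on_box` words the box from four `U`-edge quadratics in `t` plus the corner facts (fan range affine, left bracket `K_a ≤ 2td₁` bilinear, right
bracket `2td₂ < K_b` strict).

* §1 `ObsStiffnessSeqCeilingAt_halfFilling_of_fanSource_mottStation_cleared`; §2 `ObsStiffnessSeqCeilingAt_halfFilling_on_box_of_fanSource_mottStation`.

References: T. Koma, H. Tasaki, J. Stat. Phys. 76 (1994) 745, §1 [KomaTasaki1994]; D. J. Scalapino, S. R. White, S.-C. Zhang, PRB 47 (1993) 7995, §II [ScalapinoWhiteZhang1993];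
E. H. Lieb, F. Y. Wu, Physica A 321 (2003) 1, §1 eq. (3) [LiebWuPhysicaA2003]; E. H. Lieb, PRL 62 (1989) 1201, Theorem 2 [LiebPRL1989].
-/

noncomputable section

namespace Summit.Ventures.CertifiedManyBodySolver.Observables

open Literature.MathematicalPhysics.QuantumLattice
open Literature.MathematicalPhysics.QuantumLattice.ThermodynamicLimit
open Literature.MathematicalPhysics.QuantumFieldTheory
open Literature.Probability.LatticeModels
open Matrix Finset Filter Topology HubbardWave0
open scoped Matrix BigOperators ComplexOrder

/-! ## §1 The cleared point master: fan (left, universal floor) × Mott station (right, witness) at half filling -/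

section Cleared

variable {t U U₁ U₀ sa : ℝ}

/-- **FAN × MOTT STATION, CLEARED (n = 1).** Fan station `0 ≤ U₁ < U` with slot `s_a` and an AFFINE hopping floor `α_a + β_aκ` on `[κlo_a, κhi_a]` (universal on its class at
`n = 1`); Mott station `(0, U₀)`, `0 ≤ U₀ < U`, with kinetic ceiling `−k ≤ X` on its class. With `d₁ = U − U₁`, `d₂ = U − U₀`, `K_a = Us_a − U₁t`, `K_b = U·0 − U₀t`: range
`κlo_a d₁ ≤ K_a ≤ κhi_a d₁`, bracket `K_a ≤ 2td₁` and STRICT `2td₂ < K_b`, and `0 ≤ 4c(K_b d₁ − K_a d₂) + (K_b − 2td₂)(α_a d₁ + β_a K_a) + (2td₁ − K_a)(−X·d₂)` ⇒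
`ObsStiffnessSeqCeilingAt t U 1 c`. [cite: KomaTasaki1994, §1] [cite: ScalapinoWhiteZhang1993, §II] [cite: LiebWuPhysicaA2003, §1 eq. (3)] -/
theorem ObsStiffnessSeqCeilingAt_halfFilling_of_fanSource_mottStation_cleared (hU₁0 : 0 ≤ U₁) (hU₁ : U₁ < U)
    (hU₀0 : 0 ≤ U₀) (hU₀ : U₀ < U) {αa βa κloa κhia X : ℝ}
    (ha : ∀ κ : ℝ, κloa ≤ κ → κ ≤ κhia →
      ∀ (ω : InfVolFermionState 2) (Ls : ℕ → ℕ) (ψ : ∀ L, Fock (Orb (FermionTorus 2 L))),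
      Tendsto Ls atTop atTop →
      (∀ j, IsGroundStateInSector (hubbardTorusTT' (Ls j) 1 sa U₁) (rectN 1 (Ls j)) 0 (ψ (Ls j))) →
      (∀ j, star (ψ (Ls j)) ⬝ᵥ ψ (Ls j) = 1) → ω.IsTorusLimitOf ψ Ls →
      αa + βa * κ ≤ ω.meanEnergy (hubbardTTPrimeFermionInteraction 1 κ 0) 1)
    (hX : ∀ (ω : InfVolFermionState 2) (Ls : ℕ → ℕ) (ψ : ∀ L, Fock (Orb (FermionTorus 2 L))),
      Tendsto Ls atTop atTop →
      (∀ j, IsGroundStateInSector (hubbardTorusTT' (Ls j) 1 0 U₀) (rectN 1 (Ls j)) 0 (ψ (Ls j))) →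
      (∀ j, star (ψ (Ls j)) ⬝ᵥ ψ (Ls j) = 1) → ω.IsTorusLimitOf ψ Ls →
      -(∑ i : Fin 2, -(1 : ℝ) * ∑ σ : Fin 2,
          ((ω.expect {0, 0 + unitVec i}
              ((cAt 0 (mem_insert_self _ _) σ)ᴴ * cAt (0 + unitVec i) (mem_insert_of_mem (mem_singleton_self _)) σ)).re +
            (ω.expect {0, 0 + unitVec i}
              ((cAt (0 + unitVec i) (mem_insert_of_mem (mem_singleton_self _)) σ)ᴴ * cAt 0 (mem_insert_self _ _) σ)).re)) ≤ X)
    (hloa : κloa * (U - U₁) ≤ U * sa - U₁ * t) (hhia : U * sa - U₁ * t ≤ κhia * (U - U₁))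
    (hbra : U * sa - U₁ * t ≤ 2 * t * (U - U₁)) (hbrb : 2 * t * (U - U₀) < U * 0 - U₀ * t) (c : ℚ)
    (hc : 0 ≤ 4 * ((c : ℚ) : ℝ) * ((U * 0 - U₀ * t) * (U - U₁) - (U * sa - U₁ * t) * (U - U₀)) +
      ((U * 0 - U₀ * t) - 2 * t * (U - U₀)) * (αa * (U - U₁) + βa * (U * sa - U₁ * t)) +
      (2 * t * (U - U₁) - (U * sa - U₁ * t)) * (-X * (U - U₀))) :
    ObsStiffnessSeqCeilingAt t U 1 c := by
  have hd₁ : 0 < U - U₁ := sub_pos.2 hU₁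
  have hd₂ : 0 < U - U₀ := sub_pos.2 hU₀
  have hE : 0 < (U * 0 - U₀ * t) * (U - U₁) - (U * sa - U₁ * t) * (U - U₀) := by nlinarith
  have hκa : (U * sa - U₁ * t) / (U - U₁) * (U - U₁) = U * sa - U₁ * t := div_mul_cancel₀ _ hd₁.ne'
  have hκb : (U * 0 - U₀ * t) / (U - U₀) * (U - U₀) = U * 0 - U₀ * t := div_mul_cancel₀ _ hd₂.ne'
  obtain ⟨ωM, LsM, ψM, hLM, hψM, h1M, hωM, hflM⟩ :=
    exists_torusLimit_halfFilling_tp0_hoppingFloor_of_negKinetic_le ((U * 0 - U₀ * t) / (U - U₀)) hX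
  refine ObsStiffnessSeqCeilingAt_of_apexSourceWitness_apexSource_weighted (s₁ := 0) (U₁ := U₀) (s₂ := sa) (U₂ := U₁) (t'P := t) (UP := U)
    (n := 1) hU₀0 hU₀ hU₁0 hU₁ zero_le_one one_lt_two
    (μ₁ := (2 * t * (U - U₁) - (U * sa - U₁ * t)) * (U - U₀) / ((U * 0 - U₀ * t) * (U - U₁) - (U * sa - U₁ * t) * (U - U₀)))
    (μ₂ := ((U * 0 - U₀ * t) - 2 * t * (U - U₀)) * (U - U₁) / ((U * 0 - U₀ * t) * (U - U₁) - (U * sa - U₁ * t) * (U - U₀)))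
    (div_nonneg (mul_nonneg (by linarith) hd₂.le) hE.le) (div_nonneg (mul_nonneg (by linarith) hd₁.le) hE.le) ?_ ?_
    ⟨ωM, LsM, ψM, hLM, hψM, h1M, hωM, hflM⟩
    (ha _ (by rw [le_div_iff₀ hd₁]; exact hloa) (by rw [div_le_iff₀ hd₁]; exact hhia)) c ?_
  · rw [← add_div, div_eq_one_iff_eq hE.ne']; ring
  · rw [div_mul_eq_mul_div, div_mul_eq_mul_div, ← add_div, div_eq_iff hE.ne']
    have e1 : (2 * t * (U - U₁) - (U * sa - U₁ * t)) * (U - U₀) * ((U * 0 - U₀ * t) / (U - U₀)) =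
        (2 * t * (U - U₁) - (U * sa - U₁ * t)) * (U * 0 - U₀ * t) := by
      rw [mul_assoc, mul_comm (U - U₀), hκb]
    have e2 : ((U * 0 - U₀ * t) - 2 * t * (U - U₀)) * (U - U₁) * ((U * sa - U₁ * t) / (U - U₁)) =
        ((U * 0 - U₀ * t) - 2 * t * (U - U₀)) * (U * sa - U₁ * t) := by
      rw [mul_assoc, mul_comm (U - U₁), hκa]
    rw [e1, e2]; ring
  · have ea : αa + βa * ((U * sa - U₁ * t) / (U - U₁)) = (αa * (U - U₁) + βa * (U * sa - U₁ * t)) / (U - U₁) := by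
      rw [eq_div_iff hd₁.ne', add_mul, mul_assoc, hκa]
    have eb : -X = (-X * (U - U₀)) / (U - U₀) := by rw [mul_div_assoc, div_self hd₂.ne', mul_one]
    rw [ea]
    have f1 : (2 * t * (U - U₁) - (U * sa - U₁ * t)) * (U - U₀) / ((U * 0 - U₀ * t) * (U - U₁) - (U * sa - U₁ * t) * (U - U₀)) * (-X) =
        (2 * t * (U - U₁) - (U * sa - U₁ * t)) * (-X * (U - U₀)) /
          ((U * 0 - U₀ * t) * (U - U₁) - (U * sa - U₁ * t) * (U - U₀)) := by
      rw [div_mul_eq_mul_div]; ring_nf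
    have f2 : ((U * 0 - U₀ * t) - 2 * t * (U - U₀)) * (U - U₁) / ((U * 0 - U₀ * t) * (U - U₁) - (U * sa - U₁ * t) * (U - U₀)) *
        ((αa * (U - U₁) + βa * (U * sa - U₁ * t)) / (U - U₁)) =
        ((U * 0 - U₀ * t) - 2 * t * (U - U₀)) * (αa * (U - U₁) + βa * (U * sa - U₁ * t)) /
          ((U * 0 - U₀ * t) * (U - U₁) - (U * sa - U₁ * t) * (U - U₀)) := by
      rw [div_mul_div_comm, mul_assoc, mul_comm (U - U₁) (αa * (U - U₁) + βa * (U * sa - U₁ * t)), ← mul_assoc,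
        mul_div_mul_right _ _ hd₁.ne']
    rw [f1, f2, ← add_div]
    have hN : -(4 * ((c : ℚ) : ℝ)) * ((U * 0 - U₀ * t) * (U - U₁) - (U * sa - U₁ * t) * (U - U₀)) ≤
        (2 * t * (U - U₁) - (U * sa - U₁ * t)) * (-X * (U - U₀)) +
          ((U * 0 - U₀ * t) - 2 * t * (U - U₀)) * (αa * (U - U₁) + βa * (U * sa - U₁ * t)) := by
      nlinarith [hc]
    have hNE := (le_div_iff₀ hE).2 hN
    linarith

end Cleared

/-! ## §2 THE MOTT × FAN BOX THEOREM (n = 1, t′ < 0): four `U`-edge families + corner facts -/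

section Box

variable {U₁ U₀ sa : ℝ}

/-- **MOTT × FAN BOX WORD (n = 1).** Fan `(s_a, U₁)` with an affine floor on `[κlo_a, κhi_a]`, Mott station `(0, U₀)` with kinetic ceiling `X`; a box `max(U₁,U₀) < U_a < U_b`, `t₁ < t₂`;
at the four corners: the fan's apex hopping in range and `K_a ≤ 2td₁`, and STRICT `2td₂ < K_b = −U₀t`; on the two `U`-edges, for every `t ∈ [t₁,t₂]`: `0 ≤ P(U_e,t)` and
`0 ≤ P(U_e,t) − q(t)(U_b−U_a)²/4`, `P` the cleared word of §1, `q(t) = 4c(0 − s_a) + (0 − 2t)(α_a + β_a s_a) + (2t − s_a)(−X + 0·0)`. Then `ObsStiffnessSeqCeilingAt t U 1 c` at EVERY point of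
the box. [cite: KomaTasaki1994, §1] [cite: ScalapinoWhiteZhang1993, §II] [cite: LiebWuPhysicaA2003, §1 eq. (3)] -/
theorem ObsStiffnessSeqCeilingAt_halfFilling_on_box_of_fanSource_mottStation (hU₁0 : 0 ≤ U₁) (hU₀0 : 0 ≤ U₀) {αa βa κloa κhia X : ℝ}
    (ha : ∀ κ : ℝ, κloa ≤ κ → κ ≤ κhia →
      ∀ (ω : InfVolFermionState 2) (Ls : ℕ → ℕ) (ψ : ∀ L, Fock (Orb (FermionTorus 2 L))),
      Tendsto Ls atTop atTop →
      (∀ j, IsGroundStateInSector (hubbardTorusTT' (Ls j) 1 sa U₁) (rectN 1 (Ls j)) 0 (ψ (Ls j))) →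
      (∀ j, star (ψ (Ls j)) ⬝ᵥ ψ (Ls j) = 1) → ω.IsTorusLimitOf ψ Ls →
      αa + βa * κ ≤ ω.meanEnergy (hubbardTTPrimeFermionInteraction 1 κ 0) 1)
    (hX : ∀ (ω : InfVolFermionState 2) (Ls : ℕ → ℕ) (ψ : ∀ L, Fock (Orb (FermionTorus 2 L))),
      Tendsto Ls atTop atTop →
      (∀ j, IsGroundStateInSector (hubbardTorusTT' (Ls j) 1 0 U₀) (rectN 1 (Ls j)) 0 (ψ (Ls j))) →
      (∀ j, star (ψ (Ls j)) ⬝ᵥ ψ (Ls j) = 1) → ω.IsTorusLimitOf ψ Ls →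
      -(∑ i : Fin 2, -(1 : ℝ) * ∑ σ : Fin 2,
          ((ω.expect {0, 0 + unitVec i}
              ((cAt 0 (mem_insert_self _ _) σ)ᴴ * cAt (0 + unitVec i) (mem_insert_of_mem (mem_singleton_self _)) σ)).re +
            (ω.expect {0, 0 + unitVec i}
              ((cAt (0 + unitVec i) (mem_insert_of_mem (mem_singleton_self _)) σ)ᴴ * cAt 0 (mem_insert_self _ _) σ)).re)) ≤ X)
    {Ua Ub t₁ t₂ : ℝ} (hUa₁ : U₁ < Ua) (hUa₂ : U₀ < Ua) (hab : Ua < Ub) (h12 : t₁ < t₂)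
    (hloa₁ : κloa * (Ua - U₁) ≤ Ua * sa - U₁ * t₁) (hloa₂ : κloa * (Ua - U₁) ≤ Ua * sa - U₁ * t₂)
    (hloa₃ : κloa * (Ub - U₁) ≤ Ub * sa - U₁ * t₁) (hloa₄ : κloa * (Ub - U₁) ≤ Ub * sa - U₁ * t₂)
    (hhia₁ : Ua * sa - U₁ * t₁ ≤ κhia * (Ua - U₁)) (hhia₂ : Ua * sa - U₁ * t₂ ≤ κhia * (Ua - U₁))
    (hhia₃ : Ub * sa - U₁ * t₁ ≤ κhia * (Ub - U₁)) (hhia₄ : Ub * sa - U₁ * t₂ ≤ κhia * (Ub - U₁))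
    (hbra₁ : Ua * sa - U₁ * t₁ ≤ 2 * t₁ * (Ua - U₁)) (hbra₂ : Ua * sa - U₁ * t₂ ≤ 2 * t₂ * (Ua - U₁))
    (hbra₃ : Ub * sa - U₁ * t₁ ≤ 2 * t₁ * (Ub - U₁)) (hbra₄ : Ub * sa - U₁ * t₂ ≤ 2 * t₂ * (Ub - U₁))
    (hbrb₁ : 2 * t₁ * (Ua - U₀) < Ua * 0 - U₀ * t₁) (hbrb₂ : 2 * t₂ * (Ua - U₀) < Ua * 0 - U₀ * t₂)
    (hbrb₃ : 2 * t₁ * (Ub - U₀) < Ub * 0 - U₀ * t₁) (hbrb₄ : 2 * t₂ * (Ub - U₀) < Ub * 0 - U₀ * t₂) (c : ℚ)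
    (hPa : ∀ t ∈ Set.Icc t₁ t₂, 0 ≤ 4 * ((c : ℚ) : ℝ) * ((Ua * 0 - U₀ * t) * (Ua - U₁) - (Ua * sa - U₁ * t) * (Ua - U₀)) +
      ((Ua * 0 - U₀ * t) - 2 * t * (Ua - U₀)) * (αa * (Ua - U₁) + βa * (Ua * sa - U₁ * t)) +
      (2 * t * (Ua - U₁) - (Ua * sa - U₁ * t)) * (-X * (Ua - U₀)))
    (hPb : ∀ t ∈ Set.Icc t₁ t₂, 0 ≤ 4 * ((c : ℚ) : ℝ) * ((Ub * 0 - U₀ * t) * (Ub - U₁) - (Ub * sa - U₁ * t) * (Ub - U₀)) +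
      ((Ub * 0 - U₀ * t) - 2 * t * (Ub - U₀)) * (αa * (Ub - U₁) + βa * (Ub * sa - U₁ * t)) +
      (2 * t * (Ub - U₁) - (Ub * sa - U₁ * t)) * (-X * (Ub - U₀)))
    (hPaW : ∀ t ∈ Set.Icc t₁ t₂, 0 ≤ 4 * ((c : ℚ) : ℝ) * ((Ua * 0 - U₀ * t) * (Ua - U₁) - (Ua * sa - U₁ * t) * (Ua - U₀)) +
      ((Ua * 0 - U₀ * t) - 2 * t * (Ua - U₀)) * (αa * (Ua - U₁) + βa * (Ua * sa - U₁ * t)) +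
      (2 * t * (Ua - U₁) - (Ua * sa - U₁ * t)) * (-X * (Ua - U₀)) -
      (4 * ((c : ℚ) : ℝ) * (0 - sa) + (0 - 2 * t) * (αa + βa * sa) + (2 * t - sa) * (-X + 0 * 0)) * ((Ub - Ua) ^ 2 / 4))
    (hPbW : ∀ t ∈ Set.Icc t₁ t₂, 0 ≤ 4 * ((c : ℚ) : ℝ) * ((Ub * 0 - U₀ * t) * (Ub - U₁) - (Ub * sa - U₁ * t) * (Ub - U₀)) +
      ((Ub * 0 - U₀ * t) - 2 * t * (Ub - U₀)) * (αa * (Ub - U₁) + βa * (Ub * sa - U₁ * t)) +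
      (2 * t * (Ub - U₁) - (Ub * sa - U₁ * t)) * (-X * (Ub - U₀)) -
      (4 * ((c : ℚ) : ℝ) * (0 - sa) + (0 - 2 * t) * (αa + βa * sa) + (2 * t - sa) * (-X + 0 * 0)) * ((Ub - Ua) ^ 2 / 4)) :
    ∀ U ∈ Set.Icc Ua Ub, ∀ t ∈ Set.Icc t₁ t₂, ObsStiffnessSeqCeilingAt t U 1 c := by
  intro U hU t ht
  have hU₁lt : U₁ < U := hUa₁.trans_le hU.1
  have hU₀lt : U₀ < U := hUa₂.trans_le hU.1
  have hloa : κloa * (U - U₁) ≤ U * sa - U₁ * t := by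
    have h := bilinear_nonneg_on_box (a := κloa * U₁) (b := sa - κloa) (c := -U₁) (d := 0) hab h12 hU ht
      (by linarith only [hloa₁]) (by linarith only [hloa₂]) (by linarith only [hloa₃]) (by linarith only [hloa₄])
    linarith only [h]
  have hhia : U * sa - U₁ * t ≤ κhia * (U - U₁) := by
    have h := bilinear_nonneg_on_box (a := -(κhia * U₁)) (b := κhia - sa) (c := U₁) (d := 0) hab h12 hU ht
      (by linarith only [hhia₁]) (by linarith only [hhia₂]) (by linarith only [hhia₃]) (by linarith only [hhia₄])
    linarith only [h]
  have hbra : U * sa - U₁ * t ≤ 2 * t * (U - U₁) := by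
    have h := bilinear_nonneg_on_box (a := 0) (b := -sa) (c := -U₁) (d := 2) hab h12 hU ht
      (by linarith only [hbra₁]) (by linarith only [hbra₂]) (by linarith only [hbra₃]) (by linarith only [hbra₄])
    linarith only [h]
  have hbrb : 2 * t * (U - U₀) < U * 0 - U₀ * t := by
    set m := min (min ((Ua * 0 - U₀ * t₁) - 2 * t₁ * (Ua - U₀)) ((Ua * 0 - U₀ * t₂) - 2 * t₂ * (Ua - U₀)))
        (min ((Ub * 0 - U₀ * t₁) - 2 * t₁ * (Ub - U₀)) ((Ub * 0 - U₀ * t₂) - 2 * t₂ * (Ub - U₀))) with hm_def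
    have hm : 0 < m :=
      lt_min (lt_min (by linarith only [hbrb₁]) (by linarith only [hbrb₂])) (lt_min (by linarith only [hbrb₃]) (by linarith only [hbrb₄]))
    have h1 : m ≤ (Ua * 0 - U₀ * t₁) - 2 * t₁ * (Ua - U₀) := (min_le_left _ _).trans (min_le_left _ _)
    have h2 : m ≤ (Ua * 0 - U₀ * t₂) - 2 * t₂ * (Ua - U₀) := (min_le_left _ _).trans (min_le_right _ _)
    have h3 : m ≤ (Ub * 0 - U₀ * t₁) - 2 * t₁ * (Ub - U₀) := (min_le_right _ _).trans (min_le_left _ _)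
    have h4 : m ≤ (Ub * 0 - U₀ * t₂) - 2 * t₂ * (Ub - U₀) := (min_le_right _ _).trans (min_le_right _ _)
    have h := bilinear_nonneg_on_box (a := -m) (b := 0) (c := U₀) (d := -2) hab h12 hU ht
      (by linarith only [h1]) (by linarith only [h2]) (by linarith only [h3]) (by linarith only [h4])
    linarith only [h, hm]
  refine ObsStiffnessSeqCeilingAt_halfFilling_of_fanSource_mottStation_cleared hU₁0 hU₁lt hU₀0 hU₀lt ha hX hloa hhia hbra hbrb c ?_
  have h := quadraticU_nonneg_on_box (U := U)
    (q := 4 * ((c : ℚ) : ℝ) * (0 - sa) + (0 - 2 * t) * (αa + βa * sa) + (2 * t - sa) * (-X + 0 * 0))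
    (p := 4 * ((c : ℚ) : ℝ) * (-(U₀ * t) - 0 * U₁ + U₁ * t + sa * U₀) + (0 - 2 * t) * (-(αa * U₁) - βa * U₁ * t) +
      (-(U₀ * t) + 2 * t * U₀) * (αa + βa * sa) + (2 * t - sa) * (-(-X * U₀) - 0 * U₀ * t) + (-(2 * t * U₁) + U₁ * t) * (-X + 0 * 0))
    (r := 4 * ((c : ℚ) : ℝ) * (U₀ * t * U₁ - U₁ * t * U₀) + (-(U₀ * t) + 2 * t * U₀) * (-(αa * U₁) - βa * U₁ * t) +
      (-(2 * t * U₁) + U₁ * t) * (-(-X * U₀) - 0 * U₀ * t))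
    hab hU (by convert hPa t ht using 1; ring) (by convert hPb t ht using 1; ring)
    (by convert hPaW t ht using 1; ring) (by convert hPbW t ht using 1; ring)
  convert h using 1
  ring

end Box

end Summit.Ventures.CertifiedManyBodySolver.Observables

end
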